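import Literature.NumberTheory.EllipticCurves.TwoDescentLocalOdd
import HarnessLib

/-!
# Local conditions of the complete `2`-descent at an odd place of multiplicative type, abstractly

The local analysis of `TwoDescentLocalOdd.lean` (Silverman, *The Arithmetic of Elliptic Curves*,
X.1, proof of Prop. X.1.4 / Example X.1.5: at an odd prime `p` with `p ∤ (e₁ - e₂)(e₁ - e₃)`,
`v_p(e₂ - e₃) = 1`, every point `(x, y)`, `y ≠ 0`, of `y² = (x - e₁)(x - e₂)(x - e₃)` has
`v_p(x - e₁)` even and `χ_p(x - e₁) = χ_p(e₂ - e₁)^{v_p(x - e₂)}`) uses nothing about `ℚ` and `p`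
beyond four properties of the pair (valuation `v`, quadratic-residue bit `χ` of the unit part):
`v` and `χ` are additive on products, `v` is ultrametric, and `χ` is locally constant
(`χ (a + b) = χ a` when `v a < v b`). This file isolates these axioms in a structure
`OddPlace F` on an arbitrary field `F` and proves the two local conditions in that generality
(`OddPlace.local_conditions_of_mult`), so that the same argument serves

* `F = ℚ` (the tree's `padicValRat`, `qrBit`; `TwoDescentLocalOdd.lean`),
* `F = ℚ_p` and, by pull-back along an embedding `K →+* ℚ_p` (`OddPlace.comap`), the split
  places of a number field `K`,
* the inert places of a quadratic field (valuation and residue character read off the norm),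

as needed for the `2`-descents over `ℚ(√41)`, `ℚ(√73)`, `ℚ(√-1)` of the rank computation
`rk E(F₄) = 6` (`E = 480a1`) of T. Dokchitser–V. Dokchitser, *A note on the Mordell–Weil rank
modulo n*, J. Number Theory 131 (2011), proof of Thm. 2 ("2-descent … over all minimal
non-trivial subfields of `F_n`").

## Contents

* `OddPlace F`: the data `v : F → ℤ`, `χ : F → ZMod 2` with the four axioms (on non-zero
  elements); `OddPlace.parity a = v a mod 2`;
* derived lemmas `v_one`, `v_neg`, `v_sq`, `add_eq_left` (ultrametric domination), `le_add_or`,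
  `χ_sq`, `χ_congr_of_lt`;
* `OddPlace.comap`: pull-back along a ring homomorphism of fields;
* `OddPlace.local_conditions_of_mult`: **the two local conditions** for `eᵢ ∈ F` with
  `v (e₁ - e₂) = v (e₁ - e₃) = 0`, `v (e₂ - e₃) = 1`:
  `Even (v (x - e₁))` and `χ (x - e₁) = parity (x - e₂) * χ (e₂ - e₁)`.

Theorems and one structure (plus its pull-back); no named facts.

## References

* J. H. Silverman, *The Arithmetic of Elliptic Curves*, 2nd ed., GTM 106 (2009), Prop. X.1.4,
  Example X.1.5. [SilvermanAEC2009]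
* T. Dokchitser, V. Dokchitser, *A note on the Mordell–Weil rank modulo n*, J. Number Theory 131
  (2011) 1833–1839, proof of Thm. 2. [DokchitserDokchitser2011RankModN]
-/

namespace Literature.NumberTheory.EllipticCurves.TwoDescentLocal

/-- **An odd place, abstractly**: an integer-valued "valuation" `v` and a `ℤ/2`-valued
"quadratic-residue bit" `χ` on a field `F` (values at `0` irrelevant) such that, on non-zero
elements, `v` and `χ` are additive on products, `v` is ultrametric and `χ` is locally constant
(`χ (a + b) = χ a` whenever `v a < v b`). Models: `(v_p, χ_p ∘ unit part)` on `ℚ` or `ℚ_p` for an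
odd prime `p`; their pull-backs along field embeddings; `(v_p ∘ N / 2, χ_p ∘ N)` on a quadratic
field at an inert odd prime `p`. [folklore] -/
structure OddPlace (F : Type*) [Field F] where
  /-- the valuation (on non-zero elements) -/
  v : F → ℤ
  /-- the quadratic-residue bit of the unit part (on non-zero elements) -/
  χ : F → ZMod 2
  v_mul' : ∀ {a b : F}, a ≠ 0 → b ≠ 0 → v (a * b) = v a + v b
  min_le_v_add' : ∀ {a b : F}, a ≠ 0 → b ≠ 0 → a + b ≠ 0 → min (v a) (v b) ≤ v (a + b)
  χ_mul' : ∀ {a b : F}, a ≠ 0 → b ≠ 0 → χ (a * b) = χ a + χ b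
  χ_add_of_lt' : ∀ {a b : F}, a ≠ 0 → b ≠ 0 → v a < v b → χ (a + b) = χ a

namespace OddPlace

variable {F : Type*} [Field F] (𝔳 : OddPlace F)

/-! ### Algebra of `v`, `χ` and the parity bit -/

/-- The parity of the valuation, in `ℤ/2`. [folklore] -/
def parity (a : F) : ZMod 2 := (𝔳.v a : ZMod 2)

/-- Unfolding `parity`. [folklore] -/
theorem parity_def (a : F) : 𝔳.parity a = (𝔳.v a : ZMod 2) := rfl

/-- `parity a = 0` iff `v a` is even. [folklore] -/
theorem parity_eq_zero_iff (a : F) : 𝔳.parity a = 0 ↔ Even (𝔳.v a) := by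
  rw [parity, ZMod.intCast_zmod_eq_zero_iff_dvd, even_iff_two_dvd]; rfl

/-- `parity a = 1` if `v a` is odd. [folklore] -/
theorem parity_eq_one_of_not_even {a : F} (h : ¬ Even (𝔳.v a)) : 𝔳.parity a = 1 := by
  have : 𝔳.parity a ≠ 0 := fun h0 => h ((𝔳.parity_eq_zero_iff a).mp h0)
  revert this; generalize 𝔳.parity a = b; decide +revert

/-- `v` is additive on products. [folklore] -/
theorem v_mul {a b : F} (ha : a ≠ 0) (hb : b ≠ 0) : 𝔳.v (a * b) = 𝔳.v a + 𝔳.v b :=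
  𝔳.v_mul' ha hb

/-- `χ` is additive on products. [folklore] -/
theorem χ_mul {a b : F} (ha : a ≠ 0) (hb : b ≠ 0) : 𝔳.χ (a * b) = 𝔳.χ a + 𝔳.χ b :=
  𝔳.χ_mul' ha hb

/-- `parity` is additive on products. [folklore] -/
theorem parity_mul {a b : F} (ha : a ≠ 0) (hb : b ≠ 0) :
    𝔳.parity (a * b) = 𝔳.parity a + 𝔳.parity b := by
  rw [parity, parity, parity, 𝔳.v_mul ha hb, Int.cast_add]

/-- `v 1 = 0`. [folklore] -/
theorem v_one : 𝔳.v 1 = 0 := by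
  have h := 𝔳.v_mul (one_ne_zero (α := F)) one_ne_zero
  rw [mul_one] at h; omega

/-- `v (-1) = 0`. [folklore] -/
theorem v_neg_one : 𝔳.v (-1) = 0 := by
  have h := 𝔳.v_mul (neg_ne_zero.mpr (one_ne_zero (α := F))) (neg_ne_zero.mpr one_ne_zero)
  rw [neg_mul_neg, mul_one, 𝔳.v_one] at h; omega

/-- `v (-a) = v a`. [folklore] -/
theorem v_neg (a : F) : 𝔳.v (-a) = 𝔳.v a := by
  by_cases ha : a = 0
  · rw [ha, neg_zero]
  · rw [← neg_one_mul, 𝔳.v_mul (neg_ne_zero.mpr one_ne_zero) ha, 𝔳.v_neg_one, zero_add]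

/-- `v (a - b) = v (b - a)`. [folklore] -/
theorem v_sub_comm (a b : F) : 𝔳.v (a - b) = 𝔳.v (b - a) := by
  rw [← neg_sub, 𝔳.v_neg]

/-- `v (a²) = 2 v a`. [folklore] -/
theorem v_sq {a : F} (ha : a ≠ 0) : 𝔳.v (a ^ 2) = 2 * 𝔳.v a := by
  rw [sq, 𝔳.v_mul ha ha, two_mul]

/-- `v (a⁻¹) = -v a`. [folklore] -/
theorem v_inv {a : F} (ha : a ≠ 0) : 𝔳.v a⁻¹ = -𝔳.v a := by
  have h := 𝔳.v_mul ha (inv_ne_zero ha)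
  rw [mul_inv_cancel₀ ha, 𝔳.v_one] at h; omega

/-- `v (a / b) = v a - v b`. [folklore] -/
theorem v_div {a b : F} (ha : a ≠ 0) (hb : b ≠ 0) : 𝔳.v (a / b) = 𝔳.v a - 𝔳.v b := by
  rw [div_eq_mul_inv, 𝔳.v_mul ha (inv_ne_zero hb), 𝔳.v_inv hb]; ring

/-- The parity bit kills squares. [folklore] -/
theorem parity_sq {a : F} (ha : a ≠ 0) : 𝔳.parity (a ^ 2) = 0 := by
  rw [parity_eq_zero_iff, 𝔳.v_sq ha]; exact even_two_mul _

/-- `χ 1 = 0`. [folklore] -/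
theorem χ_one : 𝔳.χ 1 = 0 := by
  have h := 𝔳.χ_mul (one_ne_zero (α := F)) one_ne_zero
  rw [mul_one] at h
  revert h; generalize 𝔳.χ 1 = b; decide +revert

/-- `χ (a * a) = 0`. [folklore] -/
theorem χ_mul_self {a : F} (ha : a ≠ 0) : 𝔳.χ (a * a) = 0 := by
  rw [𝔳.χ_mul ha ha]; generalize 𝔳.χ a = b; decide +revert

/-- `χ (a²) = 0`. [folklore] -/
theorem χ_sq {a : F} (ha : a ≠ 0) : 𝔳.χ (a ^ 2) = 0 := by rw [sq, 𝔳.χ_mul_self ha]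

/-- `χ (-a) = χ (-1) + χ a`. [folklore] -/
theorem χ_neg {a : F} (ha : a ≠ 0) : 𝔳.χ (-a) = 𝔳.χ (-1) + 𝔳.χ a := by
  rw [← neg_one_mul, 𝔳.χ_mul (neg_ne_zero.mpr one_ne_zero) ha]

/-- `χ (a⁻¹) = χ a`. [folklore] -/
theorem χ_inv {a : F} (ha : a ≠ 0) : 𝔳.χ a⁻¹ = 𝔳.χ a := by
  have h := 𝔳.χ_mul ha (inv_ne_zero ha)
  rw [mul_inv_cancel₀ ha, 𝔳.χ_one] at h
  revert h; generalize 𝔳.χ a = b; generalize 𝔳.χ a⁻¹ = c; decide +revert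

/-- `χ (a / b) = χ a + χ b`. [folklore] -/
theorem χ_div {a b : F} (ha : a ≠ 0) (hb : b ≠ 0) : 𝔳.χ (a / b) = 𝔳.χ a + 𝔳.χ b := by
  rw [div_eq_mul_inv, 𝔳.χ_mul ha (inv_ne_zero hb), 𝔳.χ_inv hb]

/-! ### Ultrametric lemmas -/

/-- **Ultrametric domination**: if `v a < v b` (`b ≠ 0`) then `a + b ≠ 0` and
`v (a + b) = v a`. [folklore] -/
theorem add_eq_left_of_lt {a b : F} (ha : a ≠ 0) (hb : b ≠ 0) (hlt : 𝔳.v a < 𝔳.v b) :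
    a + b ≠ 0 ∧ 𝔳.v (a + b) = 𝔳.v a := by
  have hab : a + b ≠ 0 := by
    intro hab
    have hba : b = -a := by linear_combination hab
    rw [hba, 𝔳.v_neg] at hlt
    exact lt_irrefl _ hlt
  refine ⟨hab, le_antisymm ?_ ?_⟩
  · by_contra hgt
    push Not at hgt
    have h2 := 𝔳.min_le_v_add' hab (neg_ne_zero.mpr hb) (by rw [add_neg_cancel_right]; exact ha)
    rw [add_neg_cancel_right, 𝔳.v_neg] at h2
    have : min (𝔳.v (a + b)) (𝔳.v b) > 𝔳.v a := lt_min hgt hlt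
    exact absurd h2 (not_le.mpr this)
  · have h1 := 𝔳.min_le_v_add' ha hb hab
    rwa [min_eq_left hlt.le] at h1

/-- Ultrametric domination, in the form of the tree's `padicValRat_add_eq_left`: if `b = 0` or
`v a < v b` with `b ≠ 0`, then `a + b ≠ 0` and `v (a + b) = v a`. [folklore] -/
theorem add_eq_left {a b : F} (ha : a ≠ 0) (h : b = 0 ∨ (b ≠ 0 ∧ 𝔳.v a < 𝔳.v b)) :
    a + b ≠ 0 ∧ 𝔳.v (a + b) = 𝔳.v a := by
  rcases h with rfl | ⟨hb, hlt⟩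
  · rw [add_zero]; exact ⟨ha, rfl⟩
  · exact 𝔳.add_eq_left_of_lt ha hb hlt

/-- A lower bound for the valuation of a sum that may vanish: if each of `a`, `b` is `0` or has
`v ≥ c`, then `a + b = 0` or `v (a + b) ≥ c`. [folklore] -/
theorem le_add_or {a b : F} {c : ℤ} (ha : a = 0 ∨ c ≤ 𝔳.v a) (hb : b = 0 ∨ c ≤ 𝔳.v b) :
    a + b = 0 ∨ c ≤ 𝔳.v (a + b) := by
  by_cases hab : a + b = 0
  · exact Or.inl hab
  refine Or.inr ?_
  by_cases ha0 : a = 0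
  · subst ha0
    rw [zero_add] at hab ⊢
    exact hb.resolve_left hab
  by_cases hb0 : b = 0
  · subst hb0
    rw [add_zero] at hab ⊢
    exact ha.resolve_left hab
  exact (le_min (ha.resolve_left ha0) (hb.resolve_left hb0)).trans (𝔳.min_le_v_add' ha0 hb0 hab)

/-- **Local constancy of `χ`**: `χ (a + b) = χ a` if `b = 0` or `v a < v b`. [folklore] -/
theorem χ_congr_of_lt {a b : F} (ha : a ≠ 0) (h : b = 0 ∨ (b ≠ 0 ∧ 𝔳.v a < 𝔳.v b)) :
    𝔳.χ (a + b) = 𝔳.χ a := by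
  rcases h with rfl | ⟨hb, hlt⟩
  · rw [add_zero]
  · exact 𝔳.χ_add_of_lt' ha hb hlt

/-! ### Pull-back along a field homomorphism -/

/-- The pull-back of an odd place along a ring homomorphism of fields (e.g. an embedding of a
number field into `ℚ_p`). [folklore] -/
def comap {K : Type*} [Field K] (ι : K →+* F) : OddPlace K where
  v a := 𝔳.v (ι a)
  χ a := 𝔳.χ (ι a)
  v_mul' ha hb := by
    simp only [map_mul]
    exact 𝔳.v_mul ((map_ne_zero ι).mpr ha) ((map_ne_zero ι).mpr hb)
  min_le_v_add' ha hb hab := by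
    simp only [map_add]
    exact 𝔳.min_le_v_add' ((map_ne_zero ι).mpr ha) ((map_ne_zero ι).mpr hb)
      (by rw [← map_add]; exact (map_ne_zero ι).mpr hab)
  χ_mul' ha hb := by
    simp only [map_mul]
    exact 𝔳.χ_mul ((map_ne_zero ι).mpr ha) ((map_ne_zero ι).mpr hb)
  χ_add_of_lt' ha hb hlt := by
    simp only [map_add]
    exact 𝔳.χ_add_of_lt' ((map_ne_zero ι).mpr ha) ((map_ne_zero ι).mpr hb) hlt

/-- The valuation of the pull-back. [folklore] -/
@[simp] theorem comap_v {K : Type*} [Field K] (ι : K →+* F) (a : K) :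
    (𝔳.comap ι).v a = 𝔳.v (ι a) := rfl

/-- The residue bit of the pull-back. [folklore] -/
@[simp] theorem comap_χ {K : Type*} [Field K] (ι : K →+* F) (a : K) :
    (𝔳.comap ι).χ a = 𝔳.χ (ι a) := rfl

/-- The parity bit of the pull-back. [folklore] -/
@[simp] theorem comap_parity {K : Type*} [Field K] (ι : K →+* F) (a : K) :
    (𝔳.comap ι).parity a = 𝔳.parity (ι a) := rfl

/-! ### The local conditions at an odd place dividing `e₂ - e₃` once -/

section Mult

variable {𝔳}
variable {e₁ e₂ e₃ x y : F}

/-- On `y² = (x - e₁)(x - e₂)(x - e₃)` with `y ≠ 0` the three factors are non-zero (any field;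
the tree's `factors_ne_zero` is the case `F = ℚ`, `eᵢ ∈ ℤ`). [folklore] -/
theorem factors_ne_zero' (hy : y ≠ 0) (h : y ^ 2 = (x - e₁) * (x - e₂) * (x - e₃)) :
    x - e₁ ≠ 0 ∧ x - e₂ ≠ 0 ∧ x - e₃ ≠ 0 := by
  have h₀ : (x - e₁) * (x - e₂) * (x - e₃) ≠ 0 := h ▸ pow_ne_zero 2 hy
  exact ⟨fun h0 => h₀ (by rw [h0, zero_mul, zero_mul]),
    fun h0 => h₀ (by rw [h0, mul_zero, zero_mul]), fun h0 => h₀ (by rw [h0, mul_zero])⟩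

/-- The bits of the three factors sum to zero (their product is the square `y²`). [folklore] -/
theorem χ_add_add_eq_zero (hy : y ≠ 0) (h : y ^ 2 = (x - e₁) * (x - e₂) * (x - e₃)) :
    𝔳.χ (x - e₁) + 𝔳.χ (x - e₂) + 𝔳.χ (x - e₃) = 0 := by
  obtain ⟨h1, h2, h3⟩ := factors_ne_zero' hy h
  rw [← 𝔳.χ_mul h1 h2, ← 𝔳.χ_mul (mul_ne_zero h1 h2) h3, ← h, 𝔳.χ_sq hy]

/-- The valuations of the three factors sum to an even number. [folklore] -/
theorem even_sum_v (hy : y ≠ 0) (h : y ^ 2 = (x - e₁) * (x - e₂) * (x - e₃)) :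
    Even (𝔳.v (x - e₁) + 𝔳.v (x - e₂) + 𝔳.v (x - e₃)) := by
  obtain ⟨h1, h2, h3⟩ := factors_ne_zero' hy h
  have key := congrArg 𝔳.v h
  rw [𝔳.v_sq hy, 𝔳.v_mul (mul_ne_zero h1 h2) h3, 𝔳.v_mul h1 h2] at key
  exact ⟨𝔳.v y, by omega⟩

/-- **The local conditions at an odd place of multiplicative type, abstractly.** Let `𝔳` be an
odd place of `F` and `e₁, e₂, e₃ ∈ F` distinct with `v (e₁ - e₂) = v (e₁ - e₃) = 0` and
`v (e₂ - e₃) = 1`. For every `F`-point `(x, y)`, `y ≠ 0`, of `y² = (x - e₁)(x - e₂)(x - e₃)`: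
(I) `v (x - e₁)` is even; (II) `χ (x - e₁) = parity (x - e₂) · χ (e₂ - e₁)` in `ℤ/2`, i.e. the
unit class of `x - e₁` is trivial when `v (x - e₂)` is even and is that of `e₂ - e₁` when
`v (x - e₂)` is odd. (Membership of `(x - e₁, x - e₂)` in the local image, a group of order `4`,
at a prime of multiplicative reduction: Silverman AEC X.1, proof of Prop. X.1.4 / Example X.1.5;
the case analysis on `v (x - e₁) <, =, > 0` of the tree's `local_conditions_of_mult`, verbatim.)
[cite: SilvermanAEC2009, Prop. X.1.4] -/
theorem local_conditions_of_mult (hv₁₂ : 𝔳.v (e₁ - e₂) = 0) (hv₁₃ : 𝔳.v (e₁ - e₃) = 0)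
    (h₂₃ : 𝔳.v (e₂ - e₃) = 1) (he₁₂ : e₁ ≠ e₂) (he₁₃ : e₁ ≠ e₃) (he₂₃ : e₂ ≠ e₃)
    (hy : y ≠ 0) (h : y ^ 2 = (x - e₁) * (x - e₂) * (x - e₃)) :
    Even (𝔳.v (x - e₁)) ∧ 𝔳.χ (x - e₁) = 𝔳.parity (x - e₂) * 𝔳.χ (e₂ - e₁) := by
  obtain ⟨hx₁, hx₂, hx₃⟩ := factors_ne_zero' hy h
  have hsum := even_sum_v (𝔳 := 𝔳) hy h
  have hbits := χ_add_add_eq_zero (𝔳 := 𝔳) hy h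
  obtain ⟨aux3, auxc, -⟩ := zmod_two_aux
  -- the constants
  have he₁₂' : e₁ - e₂ ≠ 0 := sub_ne_zero.mpr he₁₂
  have he₁₃' : e₁ - e₃ ≠ 0 := sub_ne_zero.mpr he₁₃
  have he₂₁' : e₂ - e₁ ≠ 0 := sub_ne_zero.mpr (Ne.symm he₁₂)
  have he₂₃' : e₂ - e₃ ≠ 0 := sub_ne_zero.mpr he₂₃
  have he₃₂' : e₃ - e₂ ≠ 0 := sub_ne_zero.mpr (Ne.symm he₂₃)
  have hv₂₁ : 𝔳.v (e₂ - e₁) = 0 := by rw [𝔳.v_sub_comm, hv₁₂]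
  have hv₃₂ : 𝔳.v (e₃ - e₂) = 1 := by rw [𝔳.v_sub_comm, h₂₃]
  -- the relations between the factors
  have r₂ : x - e₂ = (x - e₁) + (e₁ - e₂) := by ring
  have r₃ : x - e₃ = (x - e₁) + (e₁ - e₃) := by ring
  have r₁' : x - e₁ = (e₂ - e₁) + (x - e₂) := by ring
  have r₃' : x - e₃ = (x - e₂) + (e₂ - e₃) := by ring
  have r₂' : x - e₂ = (x - e₃) + (e₃ - e₂) := by ring
  rcases lt_trichotomy (𝔳.v (x - e₁)) 0 with hneg | hzero | hpos
  · -- Case `v(x - e₁) < 0`: all three factors dominate equally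
    have d₂ := 𝔳.add_eq_left_of_lt hx₁ he₁₂' (by rw [hv₁₂]; exact hneg)
    have d₃ := 𝔳.add_eq_left_of_lt hx₁ he₁₃' (by rw [hv₁₃]; exact hneg)
    rw [← r₂] at d₂
    rw [← r₃] at d₃
    have heven : Even (𝔳.v (x - e₁)) := by
      rw [d₂.2, d₃.2] at hsum
      obtain ⟨k, hk⟩ := hsum
      exact ⟨k - 𝔳.v (x - e₁), by omega⟩
    refine ⟨heven, ?_⟩
    have q₂ : 𝔳.χ (x - e₂) = 𝔳.χ (x - e₁) := by
      rw [r₂]; exact 𝔳.χ_add_of_lt' hx₁ he₁₂' (by rw [hv₁₂]; exact hneg)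
    have q₃ : 𝔳.χ (x - e₃) = 𝔳.χ (x - e₁) := by
      rw [r₃]; exact 𝔳.χ_add_of_lt' hx₁ he₁₃' (by rw [hv₁₃]; exact hneg)
    rw [q₂, q₃] at hbits
    have hpar : 𝔳.parity (x - e₂) = 0 := by rw [parity_eq_zero_iff, d₂.2]; exact heven
    rw [aux3 _ hbits, hpar, zero_mul]
  · -- Case `v(x - e₁) = 0`
    refine ⟨⟨0, by rw [hzero]; rfl⟩, ?_⟩
    rcases lt_trichotomy (𝔳.v (x - e₂)) 0 with h2neg | h2zero | h2pos
    · -- `v(x - e₂) < 0` is impossible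
      exfalso
      have d := 𝔳.add_eq_left_of_lt hx₂ he₂₁' (by rw [hv₂₁]; exact h2neg)
      rw [add_comm, ← r₁'] at d
      rw [d.2] at hzero
      exact absurd hzero h2neg.ne
    · -- all three factors are units, `x - e₃ ≡ x - e₂`
      have hv₃ : 𝔳.v (x - e₃) = 0 := by
        rcases lt_trichotomy (𝔳.v (x - e₃)) 0 with h3 | h3 | h3
        · exfalso
          have d := 𝔳.add_eq_left_of_lt hx₃ he₃₂' (by rw [hv₃₂]; omega)
          rw [← r₂'] at d
          rw [d.2] at h2zero
          exact absurd h2zero h3.ne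
        · exact h3
        · exfalso
          have d := 𝔳.le_add_or (a := x - e₃) (b := e₃ - e₂) (c := 1)
            (Or.inr (by omega)) (Or.inr (by rw [hv₃₂]))
          rw [← r₂'] at d
          rcases d with d | d
          · exact hx₂ d
          · rw [h2zero] at d; exact absurd d (by norm_num)
      have q₃ : 𝔳.χ (x - e₃) = 𝔳.χ (x - e₂) := by
        rw [r₃']; exact 𝔳.χ_add_of_lt' hx₂ he₂₃' (by rw [h2zero, h₂₃]; norm_num)
      rw [q₃] at hbits
      have hpar : 𝔳.parity (x - e₂) = 0 := by rw [parity_eq_zero_iff, h2zero]; exact ⟨0, rfl⟩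
      rw [auxc _ _ hbits, hpar, zero_mul]
    · -- `x ≡ e₂ ≡ e₃`: `x - e₁ ≡ e₂ - e₁`, and `v(x - e₂)` is odd
      have q₁ : 𝔳.χ (x - e₁) = 𝔳.χ (e₂ - e₁) := by
        rw [r₁']; exact 𝔳.χ_add_of_lt' he₂₁' hx₂ (by rw [hv₂₁]; exact h2pos)
      have hodd : ¬ Even (𝔳.v (x - e₂)) := by
        intro hev
        rcases (show 𝔳.v (x - e₂) = 1 ∨ 1 < 𝔳.v (x - e₂) by omega) with h21 | h21
        · rw [h21] at hev; exact Int.not_even_one hev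
        · -- `v(x - e₃) = 1`, so `0 + v₂ + 1` is even
          have d := 𝔳.add_eq_left_of_lt he₂₃' hx₂ (by rw [h₂₃]; exact h21)
          rw [add_comm, ← r₃'] at d
          rw [hzero, d.2, h₂₃] at hsum
          obtain ⟨k, hk⟩ := hev
          obtain ⟨m, hm⟩ := hsum
          omega
      rw [q₁, 𝔳.parity_eq_one_of_not_even hodd, one_mul]
  · -- Case `v(x - e₁) > 0`: the other two factors are the units `e₁ - e₂ ≡ e₁ - e₃`
    have d₂ := 𝔳.add_eq_left_of_lt he₁₂' hx₁ (by rw [hv₁₂]; exact hpos)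
    have d₃ := 𝔳.add_eq_left_of_lt he₁₃' hx₁ (by rw [hv₁₃]; exact hpos)
    rw [add_comm, ← r₂] at d₂
    rw [add_comm, ← r₃] at d₃
    have heven : Even (𝔳.v (x - e₁)) := by
      rw [d₂.2, d₃.2, hv₁₂, hv₁₃, add_zero, add_zero] at hsum
      exact hsum
    refine ⟨heven, ?_⟩
    have q₂ : 𝔳.χ (x - e₂) = 𝔳.χ (e₁ - e₂) := by
      rw [r₂, add_comm]; exact 𝔳.χ_add_of_lt' he₁₂' hx₁ (by rw [hv₁₂]; exact hpos)
    have q₃ : 𝔳.χ (x - e₃) = 𝔳.χ (e₁ - e₃) := by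
      rw [r₃, add_comm]; exact 𝔳.χ_add_of_lt' he₁₃' hx₁ (by rw [hv₁₃]; exact hpos)
    have q₂₃ : 𝔳.χ (e₁ - e₃) = 𝔳.χ (e₁ - e₂) := by
      rw [show e₁ - e₃ = (e₁ - e₂) + (e₂ - e₃) by ring]
      exact 𝔳.χ_add_of_lt' he₁₂' he₂₃' (by rw [hv₁₂, h₂₃]; norm_num)
    rw [q₂, q₃, q₂₃] at hbits
    have hpar : 𝔳.parity (x - e₂) = 0 := by
      rw [parity_eq_zero_iff, d₂.2, hv₁₂]; exact ⟨0, rfl⟩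
    rw [auxc _ _ hbits, hpar, zero_mul]

/-- **Local condition I**, alone: `v (x - e₁)` is even. [cite: SilvermanAEC2009, Prop. X.1.4] -/
theorem even_v_sub_of_mult (hv₁₂ : 𝔳.v (e₁ - e₂) = 0) (hv₁₃ : 𝔳.v (e₁ - e₃) = 0)
    (h₂₃ : 𝔳.v (e₂ - e₃) = 1) (he₁₂ : e₁ ≠ e₂) (he₁₃ : e₁ ≠ e₃) (he₂₃ : e₂ ≠ e₃)
    (hy : y ≠ 0) (h : y ^ 2 = (x - e₁) * (x - e₂) * (x - e₃)) :
    Even (𝔳.v (x - e₁)) :=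
  (local_conditions_of_mult hv₁₂ hv₁₃ h₂₃ he₁₂ he₁₃ he₂₃ hy h).1

/-- Local condition I as a parity bit: `parity (x - e₁) = 0`.
[cite: SilvermanAEC2009, Prop. X.1.4] -/
theorem parity_sub_of_mult (hv₁₂ : 𝔳.v (e₁ - e₂) = 0) (hv₁₃ : 𝔳.v (e₁ - e₃) = 0)
    (h₂₃ : 𝔳.v (e₂ - e₃) = 1) (he₁₂ : e₁ ≠ e₂) (he₁₃ : e₁ ≠ e₃) (he₂₃ : e₂ ≠ e₃)
    (hy : y ≠ 0) (h : y ^ 2 = (x - e₁) * (x - e₂) * (x - e₃)) :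
    𝔳.parity (x - e₁) = 0 :=
  (𝔳.parity_eq_zero_iff _).mpr (even_v_sub_of_mult hv₁₂ hv₁₃ h₂₃ he₁₂ he₁₃ he₂₃ hy h)

/-- **Local condition II**, alone: `χ (x - e₁) = parity (x - e₂) · χ (e₂ - e₁)`.
[cite: SilvermanAEC2009, Prop. X.1.4] -/
theorem χ_sub_of_mult (hv₁₂ : 𝔳.v (e₁ - e₂) = 0) (hv₁₃ : 𝔳.v (e₁ - e₃) = 0)
    (h₂₃ : 𝔳.v (e₂ - e₃) = 1) (he₁₂ : e₁ ≠ e₂) (he₁₃ : e₁ ≠ e₃) (he₂₃ : e₂ ≠ e₃)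
    (hy : y ≠ 0) (h : y ^ 2 = (x - e₁) * (x - e₂) * (x - e₃)) :
    𝔳.χ (x - e₁) = 𝔳.parity (x - e₂) * 𝔳.χ (e₂ - e₁) :=
  (local_conditions_of_mult hv₁₂ hv₁₃ h₂₃ he₁₂ he₁₃ he₂₃ hy h).2

end Mult

end OddPlace

end Literature.NumberTheory.EllipticCurves.TwoDescentLocal
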